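import Summits.Ventures.LatticeQCDFlow.Exactness.FlowSamplerMixtureHarmonicMean
import Mathlib.Analysis.SpecialFunctions.Log.NegMulLog
import Mathlib.Analysis.Convex.SpecificFunctions.Basic
import Mathlib.Analysis.Convex.Jensen
import HarnessLib

/-!
# Mixing flows is safe for the other figures of merit too: the mixture `Σ αᵢq̃ᵢ` rejects no more than the average from every state, has importance-weight second moment, forward KL and reverse KL (training loss) at most the weighted averages of its components'

HONEST FRAMING: exact (Metropolis-corrected) sampling algorithms for lattice gauge theory;
figures of merit are autocorrelation/cost numbers at stated couplings and volumes; no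
continuum-physics claim.  (SCALAR calibration rung S0-A: not a gauge result.)

Venture `LatticeQCDFlow` (cell pub-lqcd), topic `Exactness`; FANOUT row 2 (`s0-phi4`, FLOW arm).  NEW
WORK of the cell, companion of `FlowSamplerMixtureHarmonicMean` (`τ + ½` of the exact sampler with the
mixture proposal ≤ the harmonic mean of the components').  General target weight `w > 0` (measurable,
integrable) on an s-finite measure space, positive measurable integrable densities `q̃ᵢ` (normalised
where stated), weights `αᵢ > 0`, `Σ αᵢ = 1`, the mixture `q̄ = Σ αᵢq̃ᵢ`.  Pointwise convexity, then
integration: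

* `finMixture_rejection_le` — from EVERY state `x` the rejection probability of the mixture sampler is
  at most the weighted average: `r_q̄(x) ≤ Σ αᵢ r_{q̃ᵢ}(x)` (`Σ αᵢ min(aᵢ, bᵢ) ≤ min(Σαᵢaᵢ, Σαᵢbᵢ)`);
  `finMixture_meanRejection_le` — hence `∫ r_q̄ w ≤ Σ αᵢ ∫ r_{q̃ᵢ} w`;
* `finMixture_weightMoment_le` — `∫ w²/q̄ ≤ Σ αᵢ ∫ w²/q̃ᵢ` (the importance-sampling second moment /
  ESS denominator; convexity of `t ↦ 1/t`), integrability of the left side included;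
* `finMixture_forwardKL_le` — `∫ w log(w/q̄) ≤ Σ αᵢ ∫ w log(w/q̃ᵢ)` (concavity of `log`);
* `finMixture_reverseKL_le` — `∫ q̄ log(q̄/w) ≤ Σ αᵢ ∫ q̃ᵢ log(q̃ᵢ/w)` — the TRAINING LOSS of the mixture
  (up to `log Z`) is at most the average of the components' (convexity of `t ↦ t log t`).

With `FlowSamplerMixtureHarmonicMean` / `Phi4FlowMixtureHarmonicMean`: pooling several trained flows into
one mixture proposal is never worse than the (harmonic resp. arithmetic) average of running them
separately, in `τ_int`, acceptance, ESS moment and both KLs.  Textbook convexity, typed for the cell's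
exact-sampler vocabulary; nothing is cited as a fact.

NOT CLAIMED: that the mixture beats its best component in any of these; cost (every `q̃ᵢ` is evaluated
per proposal); any value for any network.
-/

namespace Summit.Ventures.LatticeQCDFlow.Exactness

open Real MeasureTheory Filter Finset Set Topology
open Summit.Ventures.LatticeQCDFlow.Scoring

variable {X : Type*} [MeasurableSpace X] {μ : Measure X} {w : X → ℝ}
  {ι : Type*} [Fintype ι] [Nonempty ι] {q : ι → X → ℝ} {α : ι → ℝ}

/-! ## §1 Rejection: from every state, the mixture rejects no more than the average -/

omit [MeasurableSpace X] [Nonempty ι] in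
/-- `Σ αᵢ min(aᵢ, bᵢ) ≤ min(Σ αᵢaᵢ, Σ αᵢbᵢ)` for `αᵢ ≥ 0`. -/
theorem sum_mul_min_le_min_sum (hα : ∀ i, 0 ≤ α i) (a b : ι → ℝ) :
    ∑ i, α i * min (a i) (b i) ≤ min (∑ i, α i * a i) (∑ i, α i * b i) := by
  refine le_min (Finset.sum_le_sum fun i _ => ?_) (Finset.sum_le_sum fun i _ => ?_)
  · exact mul_le_mul_of_nonneg_left (min_le_left _ _) (hα i)
  · exact mul_le_mul_of_nonneg_left (min_le_right _ _) (hα i)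

/-- **`r_q̄(x) ≤ Σ αᵢ r_{q̃ᵢ}(x)` for every state `x`** (`αᵢ > 0`, `Σ αᵢ = 1`, normalised `q̃ᵢ`). -/
theorem finMixture_rejection_le (hα : ∀ i, 0 < α i) (hα1 : ∑ i, α i = 1)
    (hw0 : ∀ x, 0 < w x) (hwm : Measurable w)
    (hq0 : ∀ i x, 0 < q i x) (hqm : ∀ i, Measurable (q i)) (hqi : ∀ i, Integrable (q i) μ)
    (hq1 : ∀ i, ∫ z, q i z ∂μ = 1) (x : X) :
    ∫ z, (1 - imhAcceptQ w (fun s => ∑ i, α i * q i s) x z) * (∑ i, α i * q i z) ∂μ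
      ≤ ∑ i, α i * ∫ z, (1 - imhAcceptQ w (q i) x z) * q i z ∂μ := by
  obtain ⟨hs0, hsm, hsi, hs1⟩ := finMixture_facts hα hα1 hq0 hqm hqi hq1
  rw [rejection_eq_one_sub hw0 hwm hs0 hsm hsi hs1 x]
  have hri : ∀ i, ∫ z, (1 - imhAcceptQ w (q i) x z) * q i z ∂μ
      = 1 - ∫ z, min (q i z) (w z * (q i x / w x)) ∂μ :=
    fun i => rejection_eq_one_sub hw0 hwm (hq0 i) (hqm i) (hqi i) (hq1 i) x
  simp_rw [hri, mul_sub, mul_one, Finset.sum_sub_distrib, hα1]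
  -- it remains: Σ αᵢ ∫ minᵢ ≤ ∫ min(mixture)
  have hIi : ∀ i, Integrable (fun z => min (q i z) (w z * (q i x / w x))) μ := fun i =>
    integrable_min_density hw0 hwm (hq0 i) (hqm i) (hqi i) (div_pos (hq0 i x) (hw0 x)).le
  have hIs := integrable_min_density hw0 hwm hs0 hsm hsi (div_pos (hs0 x) (hw0 x)).le
  have hsum : ∑ i, α i * ∫ z, min (q i z) (w z * (q i x / w x)) ∂μ
      = ∫ z, ∑ i, α i * min (q i z) (w z * (q i x / w x)) ∂μ := by
    rw [integral_finsetSum Finset.univ fun i _ => (hIi i).const_mul (α i)]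
    exact Finset.sum_congr rfl fun i _ => (integral_const_mul _ _).symm
  rw [hsum]
  have hpt : ∀ z, ∑ i, α i * min (q i z) (w z * (q i x / w x))
      ≤ min (∑ i, α i * q i z) (w z * ((∑ i, α i * q i x) / w x)) := fun z => by
    refine (sum_mul_min_le_min_sum (fun i => (hα i).le) _ _).trans (le_of_eq ?_)
    congr 1
    rw [Finset.sum_div, Finset.mul_sum]
    exact Finset.sum_congr rfl fun i _ => by ring
  have h := integral_mono (integrable_finsetSum Finset.univ fun i _ => (hIi i).const_mul (α i)) hIs hpt
  linarith [h]

/-- **Mean rejection: `∫ r_q̄ w ≤ Σ αᵢ ∫ r_{q̃ᵢ} w`.** -/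
theorem finMixture_meanRejection_le [SFinite μ] (hα : ∀ i, 0 < α i) (hα1 : ∑ i, α i = 1)
    (hw0 : ∀ x, 0 < w x) (hwm : Measurable w) (hwi : Integrable w μ)
    (hq0 : ∀ i x, 0 < q i x) (hqm : ∀ i, Measurable (q i)) (hqi : ∀ i, Integrable (q i) μ)
    (hq1 : ∀ i, ∫ z, q i z ∂μ = 1) :
    ∫ x, (∫ z, (1 - imhAcceptQ w (fun s => ∑ i, α i * q i s) x z) * (∑ i, α i * q i z) ∂μ) * w x ∂μ
      ≤ ∑ i, α i * ∫ x, (∫ z, (1 - imhAcceptQ w (q i) x z) * q i z ∂μ) * w x ∂μ := by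
  obtain ⟨hs0, hsm, hsi, hs1⟩ := finMixture_facts hα hα1 hq0 hqm hqi hq1
  obtain ⟨hr0, hr1, hrm⟩ := rejection_bounds (μ := μ) hw0 hwm hs0 hsm hsi hs1
  have hri := fun i => rejection_bounds (μ := μ) hw0 hwm (hq0 i) (hqm i) (hqi i) (hq1 i)
  -- integrability of the bounded rejection functions against `w`
  have hIw : ∀ {r : X → ℝ}, (∀ x, 0 ≤ r x) → (∀ x, r x ≤ 1) → Measurable r →
      Integrable (fun x => r x * w x) μ := fun hr0 hr1 hrm => by
    refine Integrable.mono' hwi (hrm.mul hwm).aestronglyMeasurable (Eventually.of_forall fun x => ?_)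
    rw [Real.norm_eq_abs, abs_of_nonneg (mul_nonneg (hr0 x) (hw0 x).le)]
    exact mul_le_of_le_one_left (hw0 x).le (hr1 x)
  have hIs := hIw hr0 hr1 hrm
  have hIi := fun i => hIw (hri i).1 (hri i).2.1 (hri i).2.2
  have hsum : ∑ i, α i * ∫ x, (∫ z, (1 - imhAcceptQ w (q i) x z) * q i z ∂μ) * w x ∂μ
      = ∫ x, ∑ i, α i * ((∫ z, (1 - imhAcceptQ w (q i) x z) * q i z ∂μ) * w x) ∂μ := by
    rw [integral_finsetSum Finset.univ fun i _ => (hIi i).const_mul (α i)]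
    exact Finset.sum_congr rfl fun i _ => (integral_const_mul _ _).symm
  rw [hsum]
  have hpt : ∀ x,
      (∫ z, (1 - imhAcceptQ w (fun s => ∑ i, α i * q i s) x z) * (∑ i, α i * q i z) ∂μ) * w x
        ≤ ∑ i, α i * ((∫ z, (1 - imhAcceptQ w (q i) x z) * q i z ∂μ) * w x) := fun x => by
    have h := finMixture_rejection_le hα hα1 hw0 hwm hq0 hqm hqi hq1 x
    calc (∫ z, (1 - imhAcceptQ w (fun s => ∑ i, α i * q i s) x z) * (∑ i, α i * q i z) ∂μ) * w x
        ≤ (∑ i, α i * ∫ z, (1 - imhAcceptQ w (q i) x z) * q i z ∂μ) * w x :=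
          mul_le_mul_of_nonneg_right h (hw0 x).le
      _ = ∑ i, α i * ((∫ z, (1 - imhAcceptQ w (q i) x z) * q i z ∂μ) * w x) := by
          rw [Finset.sum_mul]
          exact Finset.sum_congr rfl fun i _ => by ring
  exact integral_mono hIs (integrable_finsetSum Finset.univ fun i _ => (hIi i).const_mul (α i)) hpt

/-! ## §2 The importance-weight second moment -/

omit [MeasurableSpace X] [Nonempty ι] in
/-- `1/(Σ αᵢaᵢ) ≤ Σ αᵢ/aᵢ` for positive `aᵢ` and weights `αᵢ ≥ 0`, `Σ αᵢ = 1` (convexity of `1/t`). -/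
theorem inv_sum_le_sum_div (hα : ∀ i, 0 ≤ α i) (hα1 : ∑ i, α i = 1) {a : ι → ℝ}
    (ha : ∀ i, 0 < a i) : 1 / (∑ i, α i * a i) ≤ ∑ i, α i / a i := by
  have h := weightedHM_le_weightedAM (x := fun i => 1 / a i) hα hα1 (fun i => one_div_pos.2 (ha i))
  have e1 : ∑ i, α i / (1 / a i) = ∑ i, α i * a i :=
    Finset.sum_congr rfl fun i _ => by rw [div_div_eq_mul_div, div_one]
  have e2 : ∑ i, α i * (1 / a i) = ∑ i, α i / a i :=
    Finset.sum_congr rfl fun i _ => by rw [mul_one_div]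
  rw [e1, e2] at h
  exact h

/-- **`∫ w²/q̄ ≤ Σ αᵢ ∫ w²/q̃ᵢ`** (each `w²/q̃ᵢ ∈ L¹`); the left side is integrable. -/
theorem finMixture_weightMoment_le (hα : ∀ i, 0 < α i) (hα1 : ∑ i, α i = 1)
    (hw0 : ∀ x, 0 < w x) (hwm : Measurable w) (hq0 : ∀ i x, 0 < q i x)
    (hqm : ∀ i, Measurable (q i)) (hW : ∀ i, Integrable (fun x => w x / q i x * w x) μ) :
    Integrable (fun x => w x / (∑ i, α i * q i x) * w x) μ ∧
    ∫ x, w x / (∑ i, α i * q i x) * w x ∂μ ≤ ∑ i, α i * ∫ x, w x / q i x * w x ∂μ := by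
  have hs0 : ∀ x, 0 < ∑ i, α i * q i x := fun x =>
    Finset.sum_pos (fun i _ => mul_pos (hα i) (hq0 i x)) Finset.univ_nonempty
  have hsm : Measurable (fun x => ∑ i, α i * q i x) :=
    Finset.measurable_sum _ fun i _ => (hqm i).const_mul _
  have hnn : ∀ x, 0 ≤ w x / (∑ i, α i * q i x) * w x := fun x =>
    mul_nonneg (div_nonneg (hw0 x).le (hs0 x).le) (hw0 x).le
  have hpt : ∀ x, w x / (∑ i, α i * q i x) * w x ≤ ∑ i, α i * (w x / q i x * w x) := fun x => by
    have h := inv_sum_le_sum_div (fun i => (hα i).le) hα1 (a := fun i => q i x) fun i => hq0 i x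
    have hw2 : 0 ≤ w x * w x := mul_nonneg (hw0 x).le (hw0 x).le
    calc w x / (∑ i, α i * q i x) * w x = (1 / ∑ i, α i * q i x) * (w x * w x) := by ring
      _ ≤ (∑ i, α i / q i x) * (w x * w x) := mul_le_mul_of_nonneg_right h hw2
      _ = ∑ i, α i * (w x / q i x * w x) := by
          rw [Finset.sum_mul]
          exact Finset.sum_congr rfl fun i _ => by
            have := (hq0 i x).ne'
            field_simp
  have hIsum : Integrable (fun x => ∑ i, α i * (w x / q i x * w x)) μ :=
    integrable_finsetSum Finset.univ fun i _ => (hW i).const_mul (α i)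
  have hI : Integrable (fun x => w x / (∑ i, α i * q i x) * w x) μ := by
    refine Integrable.mono' hIsum (((hwm.div hsm).mul hwm).aestronglyMeasurable)
      (Eventually.of_forall fun x => ?_)
    rw [Real.norm_eq_abs, abs_of_nonneg (hnn x)]
    exact hpt x
  refine ⟨hI, ?_⟩
  calc ∫ x, w x / (∑ i, α i * q i x) * w x ∂μ ≤ ∫ x, ∑ i, α i * (w x / q i x * w x) ∂μ :=
        integral_mono hI hIsum hpt
    _ = ∑ i, α i * ∫ x, w x / q i x * w x ∂μ := by
        rw [integral_finsetSum Finset.univ fun i _ => (hW i).const_mul (α i)]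
        exact Finset.sum_congr rfl fun i _ => integral_const_mul _ _

/-! ## §3 Forward KL: `∫ w log(w/q̄) ≤ Σ αᵢ ∫ w log(w/q̃ᵢ)` -/

omit [MeasurableSpace X] [Nonempty ι] in
/-- Weighted Jensen for `log`: `Σ αᵢ log aᵢ ≤ log(Σ αᵢaᵢ)` (`aᵢ > 0`, `αᵢ ≥ 0`, `Σ αᵢ = 1`). -/
theorem sum_mul_log_le_log_sum (hα : ∀ i, 0 ≤ α i) (hα1 : ∑ i, α i = 1) {a : ι → ℝ}
    (ha : ∀ i, 0 < a i) : ∑ i, α i * Real.log (a i) ≤ Real.log (∑ i, α i * a i) := by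
  have h := (strictConcaveOn_log_Ioi.concaveOn).le_map_sum (t := Finset.univ) (w := α) (p := a)
    (fun i _ => hα i) hα1 (fun i _ => Set.mem_Ioi.2 (ha i))
  simpa [smul_eq_mul] using h

/-- **The forward KL of the mixture is at most the weighted average** (each `w log(w/q̃ᵢ) ∈ L¹`, `w ∈ L¹`,
`q̃ᵢ ∈ L¹`); the mixture's integrand is integrable. -/
theorem finMixture_forwardKL_le (hα : ∀ i, 0 < α i) (hα1 : ∑ i, α i = 1)
    (hw0 : ∀ x, 0 < w x) (hwm : Measurable w) (hwi : Integrable w μ)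
    (hq0 : ∀ i x, 0 < q i x) (hqm : ∀ i, Measurable (q i)) (hqi : ∀ i, Integrable (q i) μ)
    (hKL : ∀ i, Integrable (fun x => w x * Real.log (w x / q i x)) μ) :
    Integrable (fun x => w x * Real.log (w x / ∑ i, α i * q i x)) μ ∧
    ∫ x, w x * Real.log (w x / ∑ i, α i * q i x) ∂μ
      ≤ ∑ i, α i * ∫ x, w x * Real.log (w x / q i x) ∂μ := by
  have hs0 : ∀ x, 0 < ∑ i, α i * q i x := fun x =>
    Finset.sum_pos (fun i _ => mul_pos (hα i) (hq0 i x)) Finset.univ_nonempty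
  have hsm : Measurable (fun x => ∑ i, α i * q i x) :=
    Finset.measurable_sum _ fun i _ => (hqm i).const_mul _
  have hsi : Integrable (fun x => ∑ i, α i * q i x) μ :=
    integrable_finsetSum Finset.univ fun i _ => (hqi i).const_mul _
  -- pointwise upper bound (concavity of `log`) and lower bound (`log t ≥ 1 − 1/t`)
  have hup : ∀ x, w x * Real.log (w x / ∑ i, α i * q i x)
      ≤ ∑ i, α i * (w x * Real.log (w x / q i x)) := fun x => by
    have hJ := sum_mul_log_le_log_sum (fun i => (hα i).le) hα1 (a := fun i => q i x) fun i => hq0 i x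
    rw [Real.log_div (hw0 x).ne' (hs0 x).ne']
    have e : ∑ i, α i * (w x * Real.log (w x / q i x))
        = w x * (Real.log (w x) - ∑ i, α i * Real.log (q i x)) := by
      have hi : ∀ i, Real.log (w x / q i x) = Real.log (w x) - Real.log (q i x) :=
        fun i => Real.log_div (hw0 x).ne' (hq0 i x).ne'
      calc ∑ i, α i * (w x * Real.log (w x / q i x))
          = ∑ i, (α i * (w x * Real.log (w x)) - w x * (α i * Real.log (q i x))) :=
            Finset.sum_congr rfl fun i _ => by rw [hi]; ring
        _ = (∑ i, α i) * (w x * Real.log (w x)) - w x * ∑ i, α i * Real.log (q i x) := by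
            rw [Finset.sum_sub_distrib, Finset.sum_mul, Finset.mul_sum]
        _ = w x * (Real.log (w x) - ∑ i, α i * Real.log (q i x)) := by rw [hα1]; ring
    rw [e]
    exact mul_le_mul_of_nonneg_left (by linarith) (hw0 x).le
  have hlow : ∀ x, w x - ∑ i, α i * q i x ≤ w x * Real.log (w x / ∑ i, α i * q i x) := fun x => by
    have h := Real.one_sub_inv_le_log_of_pos (div_pos (hw0 x) (hs0 x))
    have e : w x - ∑ i, α i * q i x = w x * (1 - (w x / ∑ i, α i * q i x)⁻¹) := by
      rw [inv_div]
      have := (hw0 x).ne'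
      field_simp
    rw [e]
    exact mul_le_mul_of_nonneg_left h (hw0 x).le
  have hmeas : AEStronglyMeasurable (fun x => w x * Real.log (w x / ∑ i, α i * q i x)) μ :=
    (hwm.mul ((hwm.div hsm).log)).aestronglyMeasurable
  have hIup : Integrable (fun x => ∑ i, α i * (w x * Real.log (w x / q i x))) μ :=
    integrable_finsetSum Finset.univ fun i _ => (hKL i).const_mul (α i)
  have hI : Integrable (fun x => w x * Real.log (w x / ∑ i, α i * q i x)) μ :=
    integrable_of_le_of_le hmeas (Eventually.of_forall hlow) (Eventually.of_forall hup)
      (hwi.sub hsi) hIup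
  refine ⟨hI, ?_⟩
  calc ∫ x, w x * Real.log (w x / ∑ i, α i * q i x) ∂μ
      ≤ ∫ x, ∑ i, α i * (w x * Real.log (w x / q i x)) ∂μ := integral_mono hI hIup hup
    _ = ∑ i, α i * ∫ x, w x * Real.log (w x / q i x) ∂μ := by
        rw [integral_finsetSum Finset.univ fun i _ => (hKL i).const_mul (α i)]
        exact Finset.sum_congr rfl fun i _ => integral_const_mul _ _

/-! ## §4 Reverse KL (the training loss): `∫ q̄ log(q̄/w) ≤ Σ αᵢ ∫ q̃ᵢ log(q̃ᵢ/w)` -/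

omit [MeasurableSpace X] [Nonempty ι] in
/-- Weighted Jensen for `t log t`: `(Σαᵢaᵢ) log((Σαᵢaᵢ)/b) ≤ Σ αᵢ aᵢ log(aᵢ/b)` (`aᵢ, b > 0`). -/
theorem mixture_mul_log_div_le (hα : ∀ i, 0 ≤ α i) (hα1 : ∑ i, α i = 1) {a : ι → ℝ}
    (ha : ∀ i, 0 < a i) {b : ℝ} (hb : 0 < b) :
    (∑ i, α i * a i) * Real.log ((∑ i, α i * a i) / b) ≤ ∑ i, α i * (a i * Real.log (a i / b)) := by
  have h := Real.convexOn_mul_log.map_sum_le (t := Finset.univ) (w := α) (p := fun i => a i / b)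
    (fun i _ => hα i) hα1 (fun i _ => Set.mem_Ici.2 (div_pos (ha i) hb).le)
  simp only [smul_eq_mul] at h
  have e : ∑ i, α i * (a i / b) = (∑ i, α i * a i) / b := by
    rw [Finset.sum_div]
    exact Finset.sum_congr rfl fun i _ => by ring
  rw [e] at h
  -- `h : ((Σαa)/b) log((Σαa)/b) ≤ Σ αᵢ ((aᵢ/b) log(aᵢ/b))`; multiply by `b > 0`
  have h2 := mul_le_mul_of_nonneg_left h hb.le
  have e1 : b * ((∑ i, α i * a i) / b * Real.log ((∑ i, α i * a i) / b))
      = (∑ i, α i * a i) * Real.log ((∑ i, α i * a i) / b) := by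
    have := hb.ne'
    field_simp
  have e2 : b * ∑ i, α i * (a i / b * Real.log (a i / b)) = ∑ i, α i * (a i * Real.log (a i / b)) := by
    rw [Finset.mul_sum]
    exact Finset.sum_congr rfl fun i _ => by
      have := hb.ne'
      field_simp
  rw [e1, e2] at h2
  exact h2

/-- **The reverse KL (training loss up to `log Z`) of the mixture is at most the weighted average**
(each `q̃ᵢ log(q̃ᵢ/w) ∈ L¹`); the mixture's integrand is integrable. -/
theorem finMixture_reverseKL_le (hα : ∀ i, 0 < α i) (hα1 : ∑ i, α i = 1)
    (hw0 : ∀ x, 0 < w x) (hwm : Measurable w) (hwi : Integrable w μ)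
    (hq0 : ∀ i x, 0 < q i x) (hqm : ∀ i, Measurable (q i)) (hqi : ∀ i, Integrable (q i) μ)
    (hKL : ∀ i, Integrable (fun x => q i x * Real.log (q i x / w x)) μ) :
    Integrable (fun x => (∑ i, α i * q i x) * Real.log ((∑ i, α i * q i x) / w x)) μ ∧
    ∫ x, (∑ i, α i * q i x) * Real.log ((∑ i, α i * q i x) / w x) ∂μ
      ≤ ∑ i, α i * ∫ x, q i x * Real.log (q i x / w x) ∂μ := by
  have hs0 : ∀ x, 0 < ∑ i, α i * q i x := fun x =>
    Finset.sum_pos (fun i _ => mul_pos (hα i) (hq0 i x)) Finset.univ_nonempty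
  have hsm : Measurable (fun x => ∑ i, α i * q i x) :=
    Finset.measurable_sum _ fun i _ => (hqm i).const_mul _
  have hsi : Integrable (fun x => ∑ i, α i * q i x) μ :=
    integrable_finsetSum Finset.univ fun i _ => (hqi i).const_mul _
  have hup : ∀ x, (∑ i, α i * q i x) * Real.log ((∑ i, α i * q i x) / w x)
      ≤ ∑ i, α i * (q i x * Real.log (q i x / w x)) := fun x =>
    mixture_mul_log_div_le (fun i => (hα i).le) hα1 (a := fun i => q i x) (fun i => hq0 i x) (hw0 x)
  have hlow : ∀ x, (∑ i, α i * q i x) - w x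
      ≤ (∑ i, α i * q i x) * Real.log ((∑ i, α i * q i x) / w x) := fun x => by
    have h := Real.one_sub_inv_le_log_of_pos (div_pos (hs0 x) (hw0 x))
    have e : (∑ i, α i * q i x) - w x = (∑ i, α i * q i x) * (1 - ((∑ i, α i * q i x) / w x)⁻¹) := by
      rw [inv_div]
      have := (hs0 x).ne'
      field_simp
    rw [e]
    exact mul_le_mul_of_nonneg_left h (hs0 x).le
  have hmeas : AEStronglyMeasurable
      (fun x => (∑ i, α i * q i x) * Real.log ((∑ i, α i * q i x) / w x)) μ :=
    (hsm.mul ((hsm.div hwm).log)).aestronglyMeasurable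
  have hIup : Integrable (fun x => ∑ i, α i * (q i x * Real.log (q i x / w x))) μ :=
    integrable_finsetSum Finset.univ fun i _ => (hKL i).const_mul (α i)
  have hI : Integrable (fun x => (∑ i, α i * q i x) * Real.log ((∑ i, α i * q i x) / w x)) μ :=
    integrable_of_le_of_le hmeas (Eventually.of_forall hlow) (Eventually.of_forall hup)
      (hsi.sub hwi) hIup
  refine ⟨hI, ?_⟩
  calc ∫ x, (∑ i, α i * q i x) * Real.log ((∑ i, α i * q i x) / w x) ∂μ
      ≤ ∫ x, ∑ i, α i * (q i x * Real.log (q i x / w x)) ∂μ := integral_mono hI hIup hup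
    _ = ∑ i, α i * ∫ x, q i x * Real.log (q i x / w x) ∂μ := by
        rw [integral_finsetSum Finset.univ fun i _ => (hKL i).const_mul (α i)]
        exact Finset.sum_congr rfl fun i _ => integral_const_mul _ _

end Summit.Ventures.LatticeQCDFlow.Exactness
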